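import Summits.QuantumFields.YangMills.Theorems.BalabanUVNodesN15KingModelBoxDeterminant
import Summits.QuantumFields.YangMills.Theorems.BalabanUVNodesN15KingModelFreeEnergyDensityLimit
import HarnessLib

/-!
# BalabanUVNodes ∕ N15 — THE KING-MODEL RUNG (PART Ϟ-e): THE DUAL OF THE DOUBLED TORUS IS TILED BY THE `2^{d+1}` SHIFTED HALF GRIDS `{π(k_μ+[μ∈S])∕n_μ}`, AND EVERY SHIFTED
# HALF-GRID SUM OF `ln(m² + cΣ_μ(2−2cos p_μ))` IS A RIEMANN SUM WITH THE LIMIT `π^{−(d+1)}∫_{[0,π]^{d+1}}` — the engine of the free-boundary thermodynamic limit (part Ϟ-f)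
# (Track A, DAG node N15 = NE2; FAN-OUT v1.1 §N15 s3 «KING-MODEL RUNG»; King p.670 l.8–13 «free boundary conditions»; count-neutral)

HONEST FRAMING.  Count-neutral (cell `pub-ymgap`, seat `pub-ymgap-dag-n15-e` g41; `--supports stmt-QuantumFields-27366 --as helper` = K3⁸).
TEMPLATE LITERATURE: C. King, Commun. Math. Phys. **102** (1986) 649–677 [King1986]: (3.89)–(3.93) pp.668–669 (normalisations per unit volume), §4 p.670 l.8–13 (free boundary
conditions on `Ω`), (4.4) p.670.  Part Ε-m (g40) proved the thermodynamic limit of the free energy density on TORI by the lattice Riemann-sum engine of part Ϝ-i; part Ϟ-c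
gave `ln det(c(−Δ_free)+m²)_Ω = Σ_{k∈Ω} ln lapSym(2n)(k̂)` — a Riemann sum over the HALF grid `{πk_μ∕n_μ}` of `[0,π)^{d+1}`.  THIS FILE: the dual torus of the DOUBLED torus
`Π ℤ∕2n_μ` is tiled (part Ν-b `tilingEquiv`, read on momenta) by the `2^{d+1}` SHIFTED half grids `{π(k_μ + [μ∈S])∕n_μ}`, `S ⊆ {0,…,d}` (EXACT finite identity), and each shifted
half-grid sum is a Riemann sum converging to `π^{−(d+1)}∫_{[0,π]^{d+1}}` (the `2^{d+1}` half-open zones are a.e. the closed one — no reflection of the integral is used).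
§1 `cos_sOf_eq_of_rep` (the reduced momentum through any representative, inside `cos`), ★ `cos_sOf_torReflS_dblBox` (`cos p′_μ(σ_S k̂) = cos(π(k_μ+[μ∈S])∕n_μ)`), **`boxLogSymSum n c m² S
= Σ_{k∈Ω} kingLogSym(π(k+1_S)∕n)`** (def: the shifted half-grid sum), `log_lapSym_torReflS_dblBox`, ★★ **`sum_log_lapSym_dblTorus_eq`** (`Σ_{q∈T̂(2n)} ln lapSym(q) = Σ_S boxLogSymSum S`),
★ `log_det_boxOp_eq_boxLogSymSum` (`ln det(c(−Δ_free)+m²)_Ω = boxLogSymSum ∅`), `card_kingBox`.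
§2 (the engine on a shifted half grid) **`boxRiemannTerm`**, **`boxShiftIdx`** (defs), `boxShiftIdx_injective`, `mem_range_boxShiftIdx_iff`, `boxRiemannTerm_eq_zero`, `boxRiemannTerm_boxShiftIdx`,
★ `boxLogSymSum_eq_latticeSum`, `floorBox_iff_of_not_mem` (unshifted coordinate: in-box ⟺ `0 ≤ t < π`, exactly), `eventually_floorBox_iff_of_mem` (shifted: eventually ⟺ `0 < t ≤ π`),
**`halfZoneIntegral c m² d = ∫_{[0,π]^{d+1}} kingLogSym`** (def), `integral_indicator_shiftZone_eq` (`Measure.ae_eq_set_pi` + `Ioc∕Ico_ae_eq_Icc`), ★★★ **`tendsto_boxLogSymSum_div`**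
(`(Π_νn_{j,ν})⁻¹·boxLogSymSum n_j S → π^{−(d+1)}·halfZoneIntegral` for EVERY shift `S`, along any boxes with all sides `→ ∞`).

PRIOR TREE ART (named, USED not restated): Ϟ-c (`log_det_boxOp`, `lapSym_dblBox`), Ν-a∕Ν-b (`dblBox`, `torReflS`, `dblPer`, `sum_dblTorus_eq_sum_images`), Ε-m (`kingLogSym`,
`abs_kingLogSym_le`, `continuous_kingLogSym`), Ϝ-i `…LatticeRiemannSums` (`floorIdx`, `cornerPt`, `tendsto_cornerPt`, `tendsto_latticeSum_of_dominated`), `B5Prop11Plancherel` (`sOf`),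
`King1986` (`lapSym`), Mathlib (`ZMod.coe_valMinAbs`, `Real.cos_add_int_mul_two_pi`, `Measure.ae_eq_set_pi`, `Ioc_ae_eq_Icc`, `Ico_ae_eq_Icc`, `setIntegral_congr_set`, `Set.pi_univ_Icc`).
NOT Bałaban's covariant objects; NOT a node discharge (N15 is booked through n15-a's knit, untouched); nothing continuum-YM ∕ `ℝ⁴` ∕ OS ∕ Clay.  0 `sorry`; 4 plumbing defs.

HONEST SCOPE.  King's `A = 0` free symbol `ln(m² + cΣ(2−2cos p_μ))` (`c ≥ 0`, `m² > 0`) on boxes `Ω_j` with all `n_{j,μ} → ∞`; the identification of the limit with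
`kingFreeEnergyInf` and the free-boundary free energy density are part Ϟ-f.  Locators: [King1986] (3.89)–(3.93) pp.668–669, §4 p.670 l.8–13, (4.4) p.670.
-/

noncomputable section

open scoped BigOperators Topology
open Finset Filter MeasureTheory

namespace Summit.QuantumFields.YangMills.BalabanUVNodes.N15KingModelRung.TorusSpectral

open Literature.MathematicalPhysics.QuantumFieldTheory.Balaban1983to89.B5Prop11Plancherel (Tor sOf)
open Literature.MathematicalPhysics.QuantumFieldTheory.King1986.Torus
open Summit.QuantumFields.YangMills.BalabanUVNodes.N15KingModelRung.LatticeRiemann (floorIdx cornerPt tendsto_cornerPt tendsto_latticeSum_of_dominated)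
open Summit.QuantumFields.YangMills.BalabanUVNodes.N15KingModelRung.FreeField (gaussNorm)

variable {d : ℕ}

/-! ## §1 The dual of the doubled torus is tiled by the `2^{d+1}` shifted half grids -/

section Tiling

/-- the reduced momentum inside a cosine may be computed through ANY integer representative: `cos p′_μ(q) = cos(2πr∕K_μ)` if `r ≡ q_μ (mod K_μ)`. [cite: King1986, (4.1) p.670] -/
theorem cos_sOf_eq_of_rep (K : Fin (d + 1) → ℕ) [∀ μ, NeZero (K μ)] (q : Tor K) (μ : Fin (d + 1)) (r : ℤ) (hr : ((r : ℤ) : ZMod (K μ)) = q μ) :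
    Real.cos (sOf K q μ) = Real.cos (2 * Real.pi * r / K μ) := by
  have hK : (K μ : ℝ) ≠ 0 := by exact_mod_cast NeZero.ne (K μ)
  have hdvd : (K μ : ℤ) ∣ ((q μ).valMinAbs : ℤ) - r := by
    rw [← ZMod.intCast_eq_intCast_iff_dvd_sub, hr, ZMod.coe_valMinAbs]
  obtain ⟨t, ht⟩ := hdvd
  have hv : ((q μ).valMinAbs : ℝ) = r + (K μ : ℝ) * t := by
    have : (((q μ).valMinAbs : ℤ) : ℝ) = ((r + K μ * t : ℤ) : ℝ) := by rw [← ht]; ring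
    push_cast at this
    exact this
  have e2 : 2 * Real.pi * ((r : ℝ) + (K μ : ℝ) * t) / (K μ : ℝ) = 2 * Real.pi * r / K μ + (t : ℝ) * (2 * Real.pi) := by
    rw [mul_add, add_div, mul_div_assoc (2 * Real.pi) ((K μ : ℝ) * t), mul_div_cancel_left₀ _ hK]
    ring
  unfold sOf
  rw [show (((q μ).valMinAbs : ℤ) : ℝ) = ((q μ).valMinAbs : ℝ) from rfl, hv, e2, Real.cos_add_int_mul_two_pi]

variable (n : Fin (d + 1) → ℕ) [hn : ∀ μ, NeZero (n μ)]

/-- ★ the reduced momenta of the reflected half-grid point `σ_S k̂` inside the cosine: `cos p′_μ(σ_S k̂) = cos(π(k_μ + [μ∈S])∕n_μ)` (`−1−k_μ` represents `σ_S k̂_μ` for `μ ∈ S`; `cos` is even).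
[cite: King1986, (4.1) p.670, §4 p.670] -/
theorem cos_sOf_torReflS_dblBox (S : Finset (Fin (d + 1))) (k : KingBox n) (μ : Fin (d + 1)) :
    Real.cos (sOf (dblPer n) (torReflS (dblPer n) S (dblBox n k)) μ) = Real.cos (Real.pi * ((k μ).val + if μ ∈ S then (1 : ℝ) else 0) / n μ) := by
  have hn0 : (n μ : ℝ) ≠ 0 := by exact_mod_cast NeZero.ne (n μ)
  by_cases hμ : μ ∈ S
  · have hrep : (((-1 - ((k μ).val : ℤ) : ℤ)) : ZMod (dblPer n μ)) = torReflS (dblPer n) S (dblBox n k) μ := by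
      simp only [torReflS, if_pos hμ, dblBox]
      push_cast
      rfl
    rw [cos_sOf_eq_of_rep (dblPer n) _ μ _ hrep, if_pos hμ]
    simp only [dblPer]
    push_cast
    rw [show 2 * Real.pi * (-1 - ((k μ).val : ℝ)) / (2 * (n μ : ℝ)) = -(Real.pi * ((k μ).val + 1) / n μ) by field_simp; ring, Real.cos_neg]
  · have hrep : ((((k μ).val : ℤ) : ℤ) : ZMod (dblPer n μ)) = torReflS (dblPer n) S (dblBox n k) μ := by
      simp only [torReflS, if_neg hμ, dblBox]
      push_cast
      rfl
    rw [cos_sOf_eq_of_rep (dblPer n) _ μ _ hrep, if_neg hμ, add_zero]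
    simp only [dblPer]
    push_cast
    rw [mul_assoc, mul_div_mul_left _ _ (two_ne_zero' ℝ)]

omit hn in
/-- THE SHIFTED HALF-GRID SUM `Σ_{k∈Ω} ln(m² + cΣ_μ(2 − 2cos(π(k_μ + [μ∈S])∕n_μ)))`, `S ⊆ {0,…,d}` (`S = ∅`: the free-boundary free energy `ln det(c(−Δ_free)+m²)_Ω`).
[cite: King1986, (3.89) p.668, §4 p.670] -/
def boxLogSymSum (c m2 : ℝ) (S : Finset (Fin (d + 1))) : ℝ :=
  ∑ k : KingBox n, kingLogSym c m2 (fun μ => Real.pi * ((k μ).val + if μ ∈ S then (1 : ℝ) else 0) / n μ)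

/-- `ln lapSym(2n)(σ_S k̂) = kingLogSym(π(k + 1_S)∕n)`. [cite: King1986, (4.4) p.670] -/
theorem log_lapSym_torReflS_dblBox (c m2 : ℝ) (S : Finset (Fin (d + 1))) (k : KingBox n) :
    Real.log (lapSym (dblPer n) c m2 (torReflS (dblPer n) S (dblBox n k))) = kingLogSym c m2 (fun μ => Real.pi * ((k μ).val + if μ ∈ S then (1 : ℝ) else 0) / n μ) := by
  unfold lapSym kingLogSym
  simp_rw [cos_sOf_torReflS_dblBox]

/-- ★★ **THE DUAL OF THE DOUBLED TORUS IS TILED BY THE SHIFTED HALF GRIDS**: `Σ_{q∈T̂(2n)} ln lapSym(2n)(q) = Σ_{S⊆{0..d}} boxLogSymSum S` — EXACT (part Ν-b's `tilingEquiv` read on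
momenta). [cite: King1986, (4.4) p.670, §4 p.670] -/
theorem sum_log_lapSym_dblTorus_eq (c m2 : ℝ) :
    ∑ q : Tor (dblPer n), Real.log (lapSym (dblPer n) c m2 q) = ∑ S : Finset (Fin (d + 1)), boxLogSymSum n c m2 S := by
  rw [sum_dblTorus_eq_sum_images n (fun q => Real.log (lapSym (dblPer n) c m2 q))]
  refine Finset.sum_congr rfl fun S _ => ?_
  unfold boxLogSymSum
  exact Finset.sum_congr rfl fun k _ => log_lapSym_torReflS_dblBox n c m2 S k

/-- ★ `ln det(c(−Δ_free)+m²)_Ω = boxLogSymSum ∅` (`c ≥ 0`, `m² > 0`). [cite: King1986, (3.89) p.668, §4 p.670 l.8–13] -/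
theorem log_det_boxOp_eq_boxLogSymSum {c m2 : ℝ} (hc : 0 ≤ c) (hm : 0 < m2) : Real.log (boxOp n c m2).det = boxLogSymSum n c m2 ∅ := by
  rw [log_det_boxOp n hc hm]
  unfold boxLogSymSum kingLogSym
  refine Finset.sum_congr rfl fun k _ => ?_
  rw [lapSym_dblBox]
  simp only [Finset.notMem_empty, if_false, add_zero]

omit hn in
/-- `|Ω| = Π_ν n_ν`. [folklore] -/
theorem card_kingBox : Fintype.card (KingBox n) = ∏ ν, n ν := by
  simp [KingBox, Fintype.card_pi]

end Tiling

/-! ## §2 Every shifted half-grid sum is a Riemann sum with the limit `π^{−(d+1)}∫_{[0,π]^{d+1}}` -/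

section Engine

variable (n : Fin (d + 1) → ℕ) (c m2 : ℝ) (S : Finset (Fin (d + 1)))

/-- the box-supported summand on `ℤ^{d+1}`: `kingLogSym(πz∕n)` if `[ν∈S] ≤ z_ν < n_ν + [ν∈S]` for all `ν`, else `0`. [folklore] -/
def boxRiemannTerm (z : Fin (d + 1) → ℤ) : ℝ :=
  if ∀ ν, (if ν ∈ S then (1 : ℤ) else 0) ≤ z ν ∧ z ν < n ν + (if ν ∈ S then (1 : ℤ) else 0)
  then kingLogSym c m2 (cornerPt (fun ν => Real.pi / (n ν : ℝ)) z) else 0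

/-- the shifted index `k ↦ k + 1_S ∈ ℤ^{d+1}`. [folklore] -/
def boxShiftIdx (k : KingBox n) : Fin (d + 1) → ℤ := fun ν => ((k ν).val : ℤ) + if ν ∈ S then 1 else 0

/-- `boxShiftIdx` is injective. [folklore] -/
theorem boxShiftIdx_injective : Function.Injective (boxShiftIdx n S) := by
  intro k k' h
  funext ν
  have := congrFun h ν
  simp only [boxShiftIdx, add_left_inj, Nat.cast_inj] at this
  exact Fin.ext this

/-- the range of `boxShiftIdx` is the shifted integer box. [folklore] -/
theorem mem_range_boxShiftIdx_iff (z : Fin (d + 1) → ℤ) :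
    z ∈ Set.range (boxShiftIdx n S) ↔ ∀ ν, (if ν ∈ S then (1 : ℤ) else 0) ≤ z ν ∧ z ν < n ν + (if ν ∈ S then (1 : ℤ) else 0) := by
  constructor
  · rintro ⟨k, rfl⟩ ν
    simp only [boxShiftIdx]
    have := (k ν).isLt
    constructor <;> omega
  · intro h
    have h0 : ∀ ν, 0 ≤ z ν - (if ν ∈ S then (1 : ℤ) else 0) := fun ν => by have := (h ν).1; linarith
    refine ⟨fun ν => ⟨(z ν - if ν ∈ S then (1 : ℤ) else 0).toNat, ?_⟩, funext fun ν => ?_⟩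
    · have h2 := (h ν).2
      have : (((z ν - if ν ∈ S then (1 : ℤ) else 0).toNat : ℕ) : ℤ) < n ν := by rw [Int.toNat_of_nonneg (h0 ν)]; linarith
      exact_mod_cast this
    · simp only [boxShiftIdx]
      rw [Int.toNat_of_nonneg (h0 ν)]
      ring

/-- off the shifted box the summand vanishes. [folklore] -/
theorem boxRiemannTerm_eq_zero {z : Fin (d + 1) → ℤ} (hz : z ∉ Set.range (boxShiftIdx n S)) : boxRiemannTerm n c m2 S z = 0 := by
  rw [mem_range_boxShiftIdx_iff] at hz
  exact if_neg hz

/-- on the shifted box the summand is the shifted half-grid value. [folklore] -/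
theorem boxRiemannTerm_boxShiftIdx [hn : ∀ μ, NeZero (n μ)] (k : KingBox n) :
    boxRiemannTerm n c m2 S (boxShiftIdx n S k) = kingLogSym c m2 (fun μ => Real.pi * ((k μ).val + if μ ∈ S then (1 : ℝ) else 0) / n μ) := by
  unfold boxRiemannTerm
  rw [if_pos ((mem_range_boxShiftIdx_iff n S _).1 ⟨k, rfl⟩)]
  congr 1
  funext μ
  have hn0 : (n μ : ℝ) ≠ 0 := by exact_mod_cast NeZero.ne (n μ)
  simp only [cornerPt, boxShiftIdx]
  push_cast
  split_ifs <;> field_simp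

/-- ★ the shifted half-grid sum is a lattice sum: `boxLogSymSum S = Σ_{z∈ℤ^{d+1}} boxRiemannTerm S z`. [folklore] -/
theorem boxLogSymSum_eq_latticeSum [hn : ∀ μ, NeZero (n μ)] : boxLogSymSum n c m2 S = ∑' z : Fin (d + 1) → ℤ, boxRiemannTerm n c m2 S z := by
  rw [← (boxShiftIdx_injective n S).tsum_eq (fun z hz => ?_), tsum_fintype]
  · unfold boxLogSymSum
    exact Finset.sum_congr rfl fun k _ => (boxRiemannTerm_boxShiftIdx n c m2 S k).symm
  · exact Function.mem_support.mp hz |> fun h => by_contra fun hz' => h (boxRiemannTerm_eq_zero n c m2 S hz')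

/-- UNSHIFTED COORDINATE: `0 ≤ ⌊t∕(π∕m)⌋ < m` iff `0 ≤ t < π`, exactly (`m ≥ 1`). [folklore] -/
theorem floorBox_iff_of_not_mem (t : ℝ) {m : ℕ} (hm : 0 < m) :
    ((0 : ℤ) ≤ ⌊t / (Real.pi / (m : ℝ))⌋ ∧ ⌊t / (Real.pi / (m : ℝ))⌋ < m + 0) ↔ (0 ≤ t ∧ t < Real.pi) := by
  have hπ := Real.pi_pos
  have hmr : (0 : ℝ) < m := by exact_mod_cast hm
  have e : t / (Real.pi / (m : ℝ)) = t * m / Real.pi := by field_simp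
  rw [e, add_zero, Int.floor_nonneg, Int.floor_lt]
  push_cast
  rw [div_lt_iff₀ hπ]
  constructor
  · rintro ⟨h1, h2⟩
    refine ⟨?_, ?_⟩
    · by_contra h; push Not at h; have : t * m / Real.pi < 0 := div_neg_of_neg_of_pos (by nlinarith) hπ; linarith
    · nlinarith
  · rintro ⟨h1, h2⟩
    exact ⟨by positivity, by nlinarith⟩

/-- SHIFTED COORDINATE: along `M_j → ∞`, eventually `1 ≤ ⌊t∕(π∕M_j)⌋ < M_j + 1` iff `0 < t ≤ π`. [folklore] -/
theorem eventually_floorBox_iff_of_mem (t : ℝ) (Mseq : ℕ → ℕ) (hpos : ∀ j, 0 < Mseq j) (hlim : Tendsto (fun j => (Mseq j : ℝ)) atTop atTop) :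
    ∀ᶠ j in atTop, (((1 : ℤ) ≤ ⌊t / (Real.pi / (Mseq j : ℝ))⌋ ∧ ⌊t / (Real.pi / (Mseq j : ℝ))⌋ < Mseq j + 1) ↔ (0 < t ∧ t ≤ Real.pi)) := by
  have hπ := Real.pi_pos
  have e : ∀ j, t / (Real.pi / (Mseq j : ℝ)) = t * Mseq j / Real.pi := fun j => by
    have : (0 : ℝ) < Mseq j := by exact_mod_cast hpos j
    field_simp
  have key : ∀ j, (((1 : ℤ) ≤ ⌊t / (Real.pi / (Mseq j : ℝ))⌋ ∧ ⌊t / (Real.pi / (Mseq j : ℝ))⌋ < Mseq j + 1) ↔ (Real.pi ≤ t * Mseq j ∧ t * Mseq j < Real.pi * (Mseq j + 1))) := by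
    intro j
    rw [e j, Int.le_floor, Int.floor_lt]
    push_cast
    rw [le_div_iff₀ hπ, div_lt_iff₀ hπ, one_mul]
    constructor
    · rintro ⟨h1, h2⟩; exact ⟨h1, by linarith⟩
    · rintro ⟨h1, h2⟩; exact ⟨h1, by linarith⟩
  simp_rw [key]
  by_cases ht0 : 0 < t
  · by_cases ht1 : t ≤ Real.pi
    · filter_upwards [hlim.eventually_ge_atTop (Real.pi / t)] with j hj
      have hM : (0 : ℝ) < Mseq j := by exact_mod_cast hpos j
      rw [div_le_iff₀ ht0] at hj
      refine ⟨fun _ => ⟨ht0, ht1⟩, fun _ => ⟨by linarith, by nlinarith⟩⟩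
    · push Not at ht1
      filter_upwards [hlim.eventually_gt_atTop (Real.pi / (t - Real.pi))] with j hj
      have hM : (0 : ℝ) < Mseq j := by exact_mod_cast hpos j
      rw [div_lt_iff₀ (by linarith)] at hj
      refine ⟨fun ⟨_, h2⟩ => ?_, fun ⟨_, h2⟩ => absurd h2 (not_le.mpr ht1)⟩
      nlinarith
  · push Not at ht0
    refine Eventually.of_forall fun j => ⟨fun ⟨h1, _⟩ => ?_, fun ⟨h1, _⟩ => absurd h1 (not_lt.mpr ht0)⟩
    have hM : (0 : ℝ) < Mseq j := by exact_mod_cast hpos j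
    nlinarith

/-- THE HALF-ZONE INTEGRAL `∫_{[0,π]^{d+1}} ln(m² + cΣ_μ(2−2cos p_μ))dp`. [cite: King1986, (3.89)–(3.93) pp.668–669, (4.4) p.670] -/
def halfZoneIntegral (c m2 : ℝ) (d : ℕ) : ℝ := ∫ p in Set.Icc (0 : Fin (d + 1) → ℝ) (fun _ => Real.pi), kingLogSym c m2 p

omit n c m2 S in
/-- the `2^{d+1}` half-open zones `Π_ν I_ν`, `I_ν ∈ {[0,π), (0,π]}`, are a.e. the closed zone: the indicator integrals agree. [folklore] -/
theorem integral_indicator_shiftZone_eq (c m2 : ℝ) (S : Finset (Fin (d + 1))) :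
    ∫ p : Fin (d + 1) → ℝ, (if ∀ ν, (if ν ∈ S then (0 < p ν ∧ p ν ≤ Real.pi) else (0 ≤ p ν ∧ p ν < Real.pi)) then kingLogSym c m2 p else 0)
      = halfZoneIntegral c m2 d := by
  set I : Fin (d + 1) → Set ℝ := fun ν => if ν ∈ S then Set.Ioc 0 Real.pi else Set.Ico 0 Real.pi with hI
  have hmeasI : ∀ ν, MeasurableSet (I ν) := fun ν => by
    simp only [hI]; split_ifs; exacts [measurableSet_Ioc, measurableSet_Ico]
  have hfun : (fun p : Fin (d + 1) → ℝ => if ∀ ν, (if ν ∈ S then (0 < p ν ∧ p ν ≤ Real.pi) else (0 ≤ p ν ∧ p ν < Real.pi)) then kingLogSym c m2 p else 0)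
      = (Set.pi Set.univ I).indicator (kingLogSym c m2) := by
    funext p
    have hmem : (∀ ν, (if ν ∈ S then (0 < p ν ∧ p ν ≤ Real.pi) else (0 ≤ p ν ∧ p ν < Real.pi))) ↔ p ∈ Set.pi Set.univ I := by
      rw [Set.mem_univ_pi]
      refine forall_congr' fun ν => ?_
      simp only [hI]
      split_ifs
      · exact Iff.rfl.trans Set.mem_Ioc.symm
      · exact Iff.rfl.trans Set.mem_Ico.symm
    by_cases h : p ∈ Set.pi Set.univ I
    · rw [Set.indicator_of_mem h, if_pos (hmem.2 h)]
    · rw [Set.indicator_of_notMem h, if_neg (fun h' => h (hmem.1 h'))]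
  rw [hfun, integral_indicator (MeasurableSet.univ_pi hmeasI), halfZoneIntegral]
  refine setIntegral_congr_set ?_
  have hae : Set.pi Set.univ I =ᵐ[volume] Set.pi Set.univ (fun _ : Fin (d + 1) => Set.Icc 0 Real.pi) := by
    rw [volume_pi]
    refine Measure.ae_eq_set_pi fun ν _ => ?_
    simp only [hI]
    split_ifs
    · exact Ioc_ae_eq_Icc
    · exact Ico_ae_eq_Icc
  exact hae.trans (by rw [Set.pi_univ_Icc]; rfl)

variable {c m2}

/-- ★★★ **EVERY SHIFTED HALF-GRID SUM IS A RIEMANN SUM WITH THE SAME LIMIT**: along any boxes with all sides `n_{j,ν} → ∞` (`≥ 1`), for every shift `S ⊆ {0,…,d}`, `c ≥ 0`, `m² > 0`: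
`(Π_νn_{j,ν})⁻¹·boxLogSymSum n_j S → π^{−(d+1)}·∫_{[0,π]^{d+1}} ln(m²+cΣ(2−2cos p_μ))dp`. [cite: King1986, (3.89)–(3.93) pp.668–669, (4.4) p.670, §4 p.670] -/
theorem tendsto_boxLogSymSum_div (hc : 0 ≤ c) (hm : 0 < m2) (S : Finset (Fin (d + 1))) (nseq : ℕ → Fin (d + 1) → ℕ) (hpos : ∀ j ν, 0 < nseq j ν)
    (hlim : ∀ ν, Tendsto (fun j => (nseq j ν : ℝ)) atTop atTop) :
    Tendsto (fun j => (∏ ν, (nseq j ν : ℝ))⁻¹ * boxLogSymSum (nseq j) c m2 S) atTop (𝓝 ((Real.pi ^ (d + 1))⁻¹ * halfZoneIntegral c m2 d)) := by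
  have hπ := Real.pi_pos
  set ℓ : ℕ → Fin (d + 1) → ℝ := fun j ν => Real.pi / (nseq j ν : ℝ) with hℓ
  have hℓpos : ∀ j ν, 0 < ℓ j ν := fun j ν => by
    have : (0 : ℝ) < nseq j ν := by exact_mod_cast hpos j ν
    simp only [hℓ]; positivity
  have hℓ0 : ∀ ν, Tendsto (fun j => ℓ j ν) atTop (𝓝 0) := fun ν => by
    simp only [hℓ]; exact (tendsto_const_nhds (x := Real.pi)).div_atTop (hlim ν)
  set cs : ℕ → (Fin (d + 1) → ℤ) → ℝ := fun j => boxRiemannTerm (nseq j) c m2 S with hcs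
  set F : (Fin (d + 1) → ℝ) → ℝ := fun p => if ∀ ν, (if ν ∈ S then (0 < p ν ∧ p ν ≤ Real.pi) else (0 ≤ p ν ∧ p ν < Real.pi)) then kingLogSym c m2 p else 0 with hF
  set B : ℝ := |Real.log m2| + |Real.log (m2 + 4 * c * (d + 1))| with hB
  set G : (Fin (d + 1) → ℝ) → ℝ := (Set.Icc (fun _ => (0 : ℝ)) (fun _ => 2 * Real.pi)).indicator fun _ => B with hG
  have hGint : Integrable G := by
    rw [hG]
    exact (continuousOn_const.integrableOn_compact isCompact_Icc).integrable_indicator measurableSet_Icc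
  have hcs_apply : ∀ j x, cs j (floorIdx (ℓ j) x)
      = if ∀ ν, (if ν ∈ S then (1 : ℤ) else 0) ≤ ⌊x ν / (Real.pi / (nseq j ν : ℝ))⌋ ∧ ⌊x ν / (Real.pi / (nseq j ν : ℝ))⌋ < nseq j ν + (if ν ∈ S then (1 : ℤ) else 0)
        then kingLogSym c m2 (cornerPt (ℓ j) (floorIdx (ℓ j) x)) else 0 := fun j x => rfl
  have hdom : ∀ j x, |cs j (floorIdx (ℓ j) x)| ≤ G x := by
    intro j x
    rw [hcs_apply]
    split_ifs with hbox
    · have hx : x ∈ Set.Icc (fun _ : Fin (d + 1) => (0 : ℝ)) (fun _ => 2 * Real.pi) := by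
        refine ⟨fun ν => ?_, fun ν => ?_⟩
        · obtain ⟨h1, _⟩ := hbox ν
          have hM : (0 : ℝ) < nseq j ν := by exact_mod_cast hpos j ν
          have h0 : (0 : ℤ) ≤ ⌊x ν / (Real.pi / (nseq j ν : ℝ))⌋ := le_trans (by split_ifs <;> norm_num) h1
          rw [Int.floor_nonneg] at h0
          have e : x ν / (Real.pi / (nseq j ν : ℝ)) = x ν * nseq j ν / Real.pi := by field_simp
          rw [e] at h0
          show (0 : ℝ) ≤ x ν
          by_contra hneg; push Not at hneg
          have : x ν * nseq j ν / Real.pi < 0 := div_neg_of_neg_of_pos (by nlinarith) hπ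
          linarith
        · obtain ⟨_, h2⟩ := hbox ν
          have hM : (0 : ℝ) < nseq j ν := by exact_mod_cast hpos j ν
          have hM1 : (1 : ℝ) ≤ nseq j ν := by exact_mod_cast hpos j ν
          have h3 : ⌊x ν / (Real.pi / (nseq j ν : ℝ))⌋ < (nseq j ν : ℤ) + 1 := lt_of_lt_of_le h2 (by split_ifs <;> omega)
          rw [Int.floor_lt] at h3
          push_cast at h3
          have e : x ν / (Real.pi / (nseq j ν : ℝ)) = x ν * nseq j ν / Real.pi := by field_simp
          rw [e, div_lt_iff₀ hπ] at h3
          show x ν ≤ 2 * Real.pi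
          nlinarith
      rw [hG, Set.indicator_of_mem hx]
      exact abs_kingLogSym_le hc hm _
    · rw [abs_zero, hG]
      exact Set.indicator_nonneg (fun _ _ => by positivity) x
  have hlimpt : ∀ x, Tendsto (fun j => cs j (floorIdx (ℓ j) x)) atTop (𝓝 (F x)) := by
    intro x
    have hbox : ∀ᶠ j in atTop, (∀ ν, (if ν ∈ S then (1 : ℤ) else 0) ≤ ⌊x ν / (Real.pi / (nseq j ν : ℝ))⌋ ∧ ⌊x ν / (Real.pi / (nseq j ν : ℝ))⌋ < nseq j ν + (if ν ∈ S then (1 : ℤ) else 0))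
        ↔ (∀ ν, (if ν ∈ S then (0 < x ν ∧ x ν ≤ Real.pi) else (0 ≤ x ν ∧ x ν < Real.pi))) := by
      have h := Filter.eventually_all.2 fun ν => show ∀ᶠ j in atTop,
          (((if ν ∈ S then (1 : ℤ) else 0) ≤ ⌊x ν / (Real.pi / (nseq j ν : ℝ))⌋ ∧ ⌊x ν / (Real.pi / (nseq j ν : ℝ))⌋ < nseq j ν + (if ν ∈ S then (1 : ℤ) else 0))
            ↔ (if ν ∈ S then (0 < x ν ∧ x ν ≤ Real.pi) else (0 ≤ x ν ∧ x ν < Real.pi))) from by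
        by_cases hν : ν ∈ S
        · simp only [if_pos hν]
          exact eventually_floorBox_iff_of_mem (x ν) (fun j => nseq j ν) (fun j => hpos j ν) (hlim ν)
        · simp only [if_neg hν]
          exact Eventually.of_forall fun j => floorBox_iff_of_not_mem (x ν) (hpos j ν)
      filter_upwards [h] with j hj
      exact forall_congr' hj
    have hcont : Tendsto (fun j => kingLogSym c m2 (cornerPt (ℓ j) (floorIdx (ℓ j) x))) atTop (𝓝 (kingLogSym c m2 x)) :=
      ((continuous_kingLogSym hc hm).tendsto x).comp (tendsto_cornerPt ℓ hℓpos hℓ0 x)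
    by_cases hx : ∀ ν, (if ν ∈ S then (0 < x ν ∧ x ν ≤ Real.pi) else (0 ≤ x ν ∧ x ν < Real.pi))
    · have hFx : F x = kingLogSym c m2 x := by rw [hF]; exact if_pos hx
      rw [hFx]
      refine hcont.congr' ?_
      filter_upwards [hbox] with j hj
      rw [hcs_apply, if_pos (hj.2 hx)]
    · have hFx : F x = 0 := by rw [hF]; exact if_neg hx
      rw [hFx]
      refine tendsto_const_nhds.congr' ?_
      filter_upwards [hbox] with j hj
      rw [hcs_apply, if_neg (fun h => hx (hj.1 h))]
  have heng := tendsto_latticeSum_of_dominated ℓ hℓpos cs F G hGint hdom hlimpt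
  rw [show (∫ x, F x) = halfZoneIntegral c m2 d from integral_indicator_shiftZone_eq c m2 S] at heng
  have hlim' := heng.const_mul ((Real.pi ^ (d + 1))⁻¹)
  refine hlim'.congr fun j => ?_
  haveI : ∀ ν, NeZero (nseq j ν) := fun ν => ⟨(hpos j ν).ne'⟩
  have hprod : (∏ ν, ℓ j ν) = Real.pi ^ (d + 1) * (∏ ν, (nseq j ν : ℝ))⁻¹ := by
    simp only [hℓ]
    rw [Finset.prod_div_distrib, Finset.prod_const, Finset.card_univ, Fintype.card_fin, div_eq_mul_inv]
  rw [tsum_mul_left, hprod, mul_assoc, ← mul_assoc ((Real.pi ^ (d + 1))⁻¹), inv_mul_cancel₀ (pow_ne_zero _ hπ.ne'), one_mul,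
    boxLogSymSum_eq_latticeSum (nseq j) c m2 S]

end Engine

end Summit.QuantumFields.YangMills.BalabanUVNodes.N15KingModelRung.TorusSpectral

end
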